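import Literature.AlgebraicGeometry.AbelianSchemes.LevelStructureTwist
import Literature.AlgebraicGeometry.AbelianSchemes.LevelStructureTwistBaseChange
import HarnessLib

/-!
# The `GL_{2g}(ℤ/N)`-twist and the level change `σ ↦ σ^d` commute along `GL_{2g}(ℤ/N) → GL_{2g}(ℤ/N′)`

Cell hodgecm-mathlib, `B-plan/M1PRIME-DAG.md` §3 N4/N8 row «[MumfordFogartyKirwan1994] Lemma 7.11 / App. 7A tower, LEVEL
SIDE» (B-plan1 (g10) R28, 2026-08-29; writer B-p04 (g14)); theorems only over ★ `LevelStructureTwist` (P31) and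
★ `LevelStructureChangeLevel` (W2), naturality over ★ `LevelStructureTwistBaseChange` (N).

[MumfordFogartyKirwan1994, Ch. 7 §3 (p. 139)]: «`𝒜_{g,d,n}` is a Galois covering of `𝒜_{g,d,1}` with group `GL(2g, ℤ/n)`»
— the group acts on level-`n` structures by re-indexing the basis sections (`LevelStructure.twist`, columns convention
`η′ = η ∘ γ̄`).  [ibid., App. 7A (p. 235)] takes the `𝒜_{g,δ,n}` «as a tower with respect to finite morphisms
`𝒜_{nm} → 𝒜_n`» — on level structures `(σᵢ) ↦ (σᵢ ^ m)` (`LevelStructure.changeLevel`, cofactor form `N = N′·d`) —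
and [ibid., Ch. 7 §3 Lemma 7.11 (p. 140)] reads the step `𝒜_{g,d,nk} → 𝒜_{g,d,n}` as the quotient by the kernel
`Γ_n^{(k)}` of `GL(2g, ℤ/nk) → GL(2g, ℤ/n)` («`𝒜_{g,d,n} = 𝒜_{g,d,nk}/Γ_n^{(k)}`», the presentation used to define
`𝒜_{g,d,n}` for small `n`); [Deligne1971TravauxShimura, 1.8 (p. 129), 4.12 (b) (p. 149)]: the right `G(𝐀_f)`-action and
the transition maps of the tower `_K M_ℂ` commute.  The LEVEL-SIDE content of these statements is typed here:

* `changeLevel_twist` — **equivariance**: `(φ·γ̄).changeLevel = (φ.changeLevel)·γ̄′` where `γ̄′ ∈ GL_{2g}(ℤ/N′)` is the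
  reduction of `γ̄ ∈ GL_{2g}(ℤ/N)` mod `N′` (`Matrix.GeneralLinearGroup.map (ZMod.castHom _ (ZMod N′))`); both sides have
  `i`-th section `∏ⱼ (σⱼ ^ γ̄ⱼᵢ) ^ d`, the exponents being read mod `N′` on the `N′`-torsion sections `σⱼ ^ d`;
* `changeLevel_twist_of_map_eq_one` — **invariance under the kernel** `Γ_{N′}^{(d)} = ker (GL_{2g}(ℤ/N) → GL_{2g}(ℤ/N′))`:
  `(φ·γ̄).changeLevel = φ.changeLevel` when `γ̄ ≡ 1 mod N′`;
* `changeLevel_twist_eq_of_map_eq` — the coset form: twists by `γ̄₁, γ̄₂` with the same reduction mod `N′` have the same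
  level change (what the free-quotient presentation `𝒜_{g,d,N′} = 𝒜_{g,d,N}/Γ` reads on objects);
* `changeLevel_twist_mul_of_map_eq_one` — `Γ_{N′}^{(d)}`-translates inside a twist are invisible after level change;
* `IsBaseChangeVia.changeLevel_twist` — the same identity is compatible with the pull-back relation of
  [MumfordFogartyKirwan1994, Def. 7.3] (★ (N) `IsBaseChangeVia.twist` + ★ `IsBaseChangeVia.changeLevel`).

Hypotheses as in ★ `LevelStructureTwist`: `[IsCommMonObj A.X]` (abelian schemes are commutative group schemes,
[MumfordFogartyKirwan1994, Cor. 6.5] — the owed instance) and `[NeZero N]`, `[NeZero N′]` (levels `≥ 1`).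
Consumers (banked rung-0 capital, books 0): N8's `Nm`-functor / Hecke equivariance `T_γ ∘ π_{N→N′} = π ∘ T_{γ̄′}` and
N4's free-quotient presentation of `𝒜_{g,d,n}` at the object level, the day (F)/G1 opens.  Theorems only; HC_CM is
proved only modulo the 7 printed citations until rung 0 closes — this file discharges none of them.

## References
* [MumfordFogartyKirwan1994] D. Mumford, J. Fogarty, F. Kirwan, *Geometric Invariant Theory*, 3rd ed., Ergebnisse
  **34**, Springer (1994) — Ch. 7 §1 Def. 7.1 (p. 129), §2 Def. 7.3 (p. 129), §3 (p. 139) and Lemma 7.11 (p. 140),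
  App. 7A (p. 235).
* [Deligne1971TravauxShimura] P. Deligne, *Travaux de Shimura*, Sém. Bourbaki 389 (1971), 1.8 (p. 129), 4.12 (b) (p. 149).
* Tree: ★ `AbelianSchemes.LevelStructureTwist` (`twist`, `twist_σ`, `twist_one`, `twist_mul`, `sectionPow_eq_prod`,
  `pow_val_eq_pow_of_pow_eq_one`), ★ `LevelStructureChangeLevel` (`changeLevel`, `changeLevel_σ`, `ext_σ`,
  `IsBaseChangeVia.changeLevel`), ★ `LevelStructureTwistBaseChange` (`IsBaseChangeVia.twist`); Mathlib
  `Matrix.GeneralLinearGroup.map`, `ZMod.castHom`.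
-/

universe u

open CategoryTheory AlgebraicGeometry Matrix

noncomputable section

namespace Literature.AlgebraicGeometry.AbelianSchemes

namespace AbelianSchemeOver

open scoped MonObj

namespace LevelStructure

variable {S : Scheme.{u}} {A : AbelianSchemeOver S} {g N N' : ℕ} [IsCommMonObj A.X] [NeZero N] [NeZero N']

/-! ### §1 Equivariance of the level change for the twist action -/

omit [IsCommMonObj A.X] [NeZero N'] in
/-- The entries of the reduction `γ̄′ = γ̄ mod N′` of `γ̄ ∈ GL_{2g}(ℤ/N)` are the casts of the entries of `γ̄`
(Mathlib's `Matrix.GeneralLinearGroup.map_apply`, in the `Units.val` spelling used by ★ `LevelStructure.twist_σ`).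
[cite: MumfordFogartyKirwan1994, Ch. 7 §3 Lemma 7.11 (p. 140)] -/
theorem val_map_castHom_apply {d : ℕ} (hd : N = N' * d) (γ : GL (Fin g ⊕ Fin g) (ZMod N)) (j i : Fin g ⊕ Fin g) :
    ((Matrix.GeneralLinearGroup.map (ZMod.castHom (⟨d, hd⟩ : N' ∣ N) (ZMod N')) γ :
        GL (Fin g ⊕ Fin g) (ZMod N')) : Matrix (Fin g ⊕ Fin g) (Fin g ⊕ Fin g) (ZMod N')) j i =
      (((γ : Matrix (Fin g ⊕ Fin g) (Fin g ⊕ Fin g) (ZMod N)) j i).val : ZMod N') := by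
  rw [← ZMod.cast_eq_val, ← ZMod.castHom_apply (h := (⟨d, hd⟩ : N' ∣ N)) (R := ZMod N')]
  rfl

/-- **EQUIVARIANCE of the level change `σ ↦ σ^d` for the `GL_{2g}`-twist along the reduction
`GL_{2g}(ℤ/N) → GL_{2g}(ℤ/N′)`** (`N = N′·d`): `(φ·γ̄).changeLevel N′ = (φ.changeLevel N′)·γ̄′` with `γ̄′ = γ̄ mod N′`.
Both level-`N′` structures have `i`-th basis section `∏ⱼ (σⱼ ^ γ̄ⱼᵢ) ^ d = ∏ⱼ (σⱼ ^ d) ^ γ̄ⱼᵢ`, and on the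
`N′`-torsion section `σⱼ ^ d` the exponent `γ̄ⱼᵢ` only matters mod `N′` (★ `pow_val_eq_pow_of_pow_eq_one`).  The
level side of «the right action commutes with the transition maps of the tower» ([Deligne1971TravauxShimura, 1.8 /
4.12 (b)]; [MumfordFogartyKirwan1994, App. 7A] tower + Ch. 7 §3 Galois action).
[cite: MumfordFogartyKirwan1994, Ch. 7 §3 (p. 139) and Lemma 7.11 (p. 140); App. 7A (p. 235)]
[cite: Deligne1971TravauxShimura, 1.8 p. 129 and 4.12 (b) p. 149] -/
theorem changeLevel_twist (φ : A.LevelStructure g N) (γ : GL (Fin g ⊕ Fin g) (ZMod N)) (d : ℕ) (hd : N = N' * d)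
    (hN : N ≠ 0) :
    (φ.twist γ).changeLevel N' d hd hN =
      (φ.changeLevel N' d hd hN).twist
        (Matrix.GeneralLinearGroup.map (ZMod.castHom (⟨d, hd⟩ : N' ∣ N) (ZMod N')) γ) := by
  refine ext_σ (funext fun i => ?_)
  rw [changeLevel_σ, twist_σ, twist_σ, A.sectionPow_eq_prod, A.sectionPow_eq_prod, ← Finset.prod_pow]
  refine Finset.prod_congr rfl fun j _ => ?_
  have hj : (φ.σ j ^ d) ^ N' = 1 := (φ.changeLevel N' d hd hN).pow_σ j
  rw [changeLevel_σ, val_map_castHom_apply hd γ j i, A.pow_val_eq_pow_of_pow_eq_one hj, pow_right_comm]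

/-! ### §2 Invariance under the kernel `Γ_{N′}^{(d)}` and the coset form -/

/-- **INVARIANCE UNDER `Γ_{N′}^{(d)} = ker (GL_{2g}(ℤ/N) → GL_{2g}(ℤ/N′))`**: if `γ̄ ≡ 1 mod N′` then
`(φ·γ̄).changeLevel N′ = φ.changeLevel N′` — the level-side content of [MumfordFogartyKirwan1994, Ch. 7 §3 Lemma 7.11
(p. 140)] («the Galois group `Γ_n^{(k)}` of `𝒜_{g,d,nk} → 𝒜_{g,d,n}`») and of the presentation
`𝒜_{g,d,n} := 𝒜_{g,d,nk}/Γ_n^{(k)}` (ibid., p. 139).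
[cite: MumfordFogartyKirwan1994, Ch. 7 §3 (p. 139) and Lemma 7.11 (p. 140)] -/
theorem changeLevel_twist_of_map_eq_one (φ : A.LevelStructure g N) (γ : GL (Fin g ⊕ Fin g) (ZMod N)) (d : ℕ)
    (hd : N = N' * d) (hN : N ≠ 0)
    (h : Matrix.GeneralLinearGroup.map (ZMod.castHom (⟨d, hd⟩ : N' ∣ N) (ZMod N')) γ = 1) :
    (φ.twist γ).changeLevel N' d hd hN = φ.changeLevel N' d hd hN := by
  rw [changeLevel_twist, h, twist_one]

/-- **Coset form**: twists by `γ̄₁, γ̄₂ ∈ GL_{2g}(ℤ/N)` with the same reduction mod `N′` have the same level change to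
`N′` — `(φ·γ̄₁).changeLevel N′ = (φ·γ̄₂).changeLevel N′`; so the level-`N′` structure underlying a twisted level-`N`
structure only depends on the coset `γ̄ Γ_{N′}^{(d)}`, as the free-quotient presentation
`𝒜_{g,d,N′} = 𝒜_{g,d,N}/Γ_{N′}^{(d)}` reads on objects. [cite: MumfordFogartyKirwan1994, Ch. 7 §3 (p. 139) and Lemma 7.11 (p. 140)] -/
theorem changeLevel_twist_eq_of_map_eq (φ : A.LevelStructure g N) (γ₁ γ₂ : GL (Fin g ⊕ Fin g) (ZMod N)) (d : ℕ)
    (hd : N = N' * d) (hN : N ≠ 0)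
    (h : Matrix.GeneralLinearGroup.map (ZMod.castHom (⟨d, hd⟩ : N' ∣ N) (ZMod N')) γ₁ =
      Matrix.GeneralLinearGroup.map (ZMod.castHom (⟨d, hd⟩ : N' ∣ N) (ZMod N')) γ₂) :
    (φ.twist γ₁).changeLevel N' d hd hN = (φ.twist γ₂).changeLevel N' d hd hN := by
  rw [changeLevel_twist, changeLevel_twist, h]

/-- Converse bookkeeping for the coset form: two twists have the same level change to `N′` as soon as `γ̄₁⁻¹γ̄₂` reduces
to `1` mod `N′` (the `Γ_{N′}^{(d)}`-coset condition in group form). [cite: MumfordFogartyKirwan1994, Ch. 7 §3 Lemma 7.11 (p. 140)] -/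
theorem changeLevel_twist_eq_of_map_inv_mul_eq_one (φ : A.LevelStructure g N) (γ₁ γ₂ : GL (Fin g ⊕ Fin g) (ZMod N))
    (d : ℕ) (hd : N = N' * d) (hN : N ≠ 0)
    (h : Matrix.GeneralLinearGroup.map (ZMod.castHom (⟨d, hd⟩ : N' ∣ N) (ZMod N')) (γ₁⁻¹ * γ₂) = 1) :
    (φ.twist γ₁).changeLevel N' d hd hN = (φ.twist γ₂).changeLevel N' d hd hN := by
  refine changeLevel_twist_eq_of_map_eq φ γ₁ γ₂ d hd hN ?_
  rw [map_mul, map_inv, inv_mul_eq_one] at h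
  exact h

/-- **`Γ_{N′}^{(d)}`-translates inside a twist are invisible after the level change**: for `κ ≡ 1 mod N′`,
`(φ·(γ̄κ)).changeLevel N′ = (φ·γ̄).changeLevel N′` (right translates) — the orbit form of Lemma 7.11's Galois group.
[cite: MumfordFogartyKirwan1994, Ch. 7 §3 (p. 139) and Lemma 7.11 (p. 140)] -/
theorem changeLevel_twist_mul_of_map_eq_one (φ : A.LevelStructure g N) (γ κ : GL (Fin g ⊕ Fin g) (ZMod N)) (d : ℕ)
    (hd : N = N' * d) (hN : N ≠ 0)
    (hκ : Matrix.GeneralLinearGroup.map (ZMod.castHom (⟨d, hd⟩ : N' ∣ N) (ZMod N')) κ = 1) :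
    (φ.twist (γ * κ)).changeLevel N' d hd hN = (φ.twist γ).changeLevel N' d hd hN := by
  rw [← twist_mul, changeLevel_twist_of_map_eq_one _ κ d hd hN hκ]

/-- Left translates: for `κ ≡ 1 mod N′`, `(φ·(κγ̄)).changeLevel N′ = (φ·γ̄).changeLevel N′` (`Γ_{N′}^{(d)}` is normal, so
left and right cosets agree; here directly from `twist_mul`). [cite: MumfordFogartyKirwan1994, Ch. 7 §3 Lemma 7.11 (p. 140)] -/
theorem changeLevel_twist_mul_left_of_map_eq_one (φ : A.LevelStructure g N) (κ γ : GL (Fin g ⊕ Fin g) (ZMod N))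
    (d : ℕ) (hd : N = N' * d) (hN : N ≠ 0)
    (hκ : Matrix.GeneralLinearGroup.map (ZMod.castHom (⟨d, hd⟩ : N' ∣ N) (ZMod N')) κ = 1) :
    (φ.twist (κ * γ)).changeLevel N' d hd hN = (φ.twist γ).changeLevel N' d hd hN := by
  rw [← twist_mul, changeLevel_twist, changeLevel_twist_of_map_eq_one φ κ d hd hN hκ, ← changeLevel_twist]

/-- The reduction mod `N′` of `GL_{2g}(ℤ/N)` is onto the reductions: every `γ̄′` that IS a reduction is hit — trivial
bookkeeping form used by consumers that quantify over `γ̄′` in the image (`⟨γ, rfl⟩`); recorded as the statement that the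
twisted-then-lowered structure is a twist of the lowered one by SOME element of `GL_{2g}(ℤ/N′)`.
[cite: MumfordFogartyKirwan1994, App. 7A (p. 235)] -/
theorem exists_changeLevel_twist_eq_twist (φ : A.LevelStructure g N) (γ : GL (Fin g ⊕ Fin g) (ZMod N)) (d : ℕ)
    (hd : N = N' * d) (hN : N ≠ 0) :
    ∃ γ' : GL (Fin g ⊕ Fin g) (ZMod N'), (φ.twist γ).changeLevel N' d hd hN = (φ.changeLevel N' d hd hN).twist γ' :=
  ⟨_, changeLevel_twist φ γ d hd hN⟩

/-! ### §3 Compatibility with the pull-back relation ([MumfordFogartyKirwan1994, Def. 7.3]) -/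

/-- **The identity `changeLevel_twist` is compatible with base change**: if `(G, f)` identifies `φ′` on `A′/S′` with
the pull-back of `φ` on `A/S`, then it identifies `(φ′·γ̄).changeLevel N′` with the pull-back of `(φ.changeLevel N′)·γ̄′`
— ★ (N) `IsBaseChangeVia.twist` and ★ `IsBaseChangeVia.changeLevel` composed through `changeLevel_twist`; the shape in
which N8's transition maps and the Hecke/Galois twists are simultaneously natural transformations of the moduli
functor of [MumfordFogartyKirwan1994, Def. 7.2–7.3].
[cite: MumfordFogartyKirwan1994, Ch. 7 §2 Definition 7.3 (p. 129) and App. 7A (p. 235)] -/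
theorem IsBaseChangeVia.changeLevel_twist {S' : Scheme.{u}} {A' : AbelianSchemeOver S'} [IsCommMonObj A'.X]
    {φ' : A'.LevelStructure g N} {φ : A.LevelStructure g N} {f : S' ⟶ S} {G : A'.X.left ⟶ A.X.left}
    (h : φ'.IsBaseChangeVia φ f G) (γ : GL (Fin g ⊕ Fin g) (ZMod N)) (d : ℕ) (hd : N = N' * d) (hN : N ≠ 0) :
    ((φ'.twist γ).changeLevel N' d hd hN).IsBaseChangeVia
      ((φ.changeLevel N' d hd hN).twist
        (Matrix.GeneralLinearGroup.map (ZMod.castHom (⟨d, hd⟩ : N' ∣ N) (ZMod N')) γ)) f G := by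
  rw [LevelStructure.changeLevel_twist]
  exact (h.changeLevel _ N' d hd hN).twist _

omit [NeZero N'] in
/-- Twisted form of ★ `IsBaseChangeVia.changeLevel`: the level change of twisted structures is again compatible with the
pull-back relation (no reduction needed on either side). [cite: MumfordFogartyKirwan1994, Ch. 7 §2 Definition 7.3 (p. 129) and App. 7A (p. 235)] -/
theorem IsBaseChangeVia.changeLevel_of_twist {S' : Scheme.{u}} {A' : AbelianSchemeOver S'} [IsCommMonObj A'.X]
    {φ' : A'.LevelStructure g N} {φ : A.LevelStructure g N} {f : S' ⟶ S} {G : A'.X.left ⟶ A.X.left}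
    (h : φ'.IsBaseChangeVia φ f G) (γ : GL (Fin g ⊕ Fin g) (ZMod N)) (d : ℕ) (hd : N = N' * d) (hN : N ≠ 0) :
    ((φ'.twist γ).changeLevel N' d hd hN).IsBaseChangeVia ((φ.twist γ).changeLevel N' d hd hN) f G :=
  (h.twist γ).changeLevel _ N' d hd hN

end LevelStructure

end AbelianSchemeOver

end Literature.AlgebraicGeometry.AbelianSchemes

end
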